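/-
Copyright: statement-level skeleton of a published paper (lit-balaban cell, Phase-2 proof seat p13, gen 2). No proof
claims beyond what the kernel checks below.
-/
import Literature.MathematicalPhysics.QuantumFieldTheory.Balaban1983to89.B4Sect5CubeBounds
import Literature.MathematicalPhysics.QuantumFieldTheory.BalabanImbrieJaffe1984to88.BIJ88RandomWalk242

/-!
# `BalabanImbrieJaffe1984to88.BIJ88Eq242Lattice` — T. Bałaban, J. Imbrie, A. Jaffe, *Effective action and cluster
properties of the abelian Higgs model*, Commun. Math. Phys. **114** (1988) 257–315 [BalabanImbrieJaffe1988], §2,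
(2.42) p. 264 [PDF 8] — **the random walk expansion (2.42) INSTANTIATED on `ℤ^d` for the operators of its model
[6] = T. Bałaban, CMP **89** (1983) Sect. 5 [Balaban1983RegularityDecay]**

statement-level skeleton of published theorems with citation tags; proofs where landed; nothing here is a claim
about the Yang–Mills mass gap.  Unit `lit-balaban-p13-g2` (cell lit-balaban, Phase 2; rows C2.Eq2.42 × B4.Eq5.15;
bridge between this seat's `…BIJ88RandomWalk242` (p244240/p245461: (2.42) typed as `Eq242 C Cw := ∀ x₁ x₂,
HasSum (ω ↦ Cw ω x₁ x₂) (C x₁ x₂)` over the label sequences `Walk ι`, and PROVED in [6]'s abstract setting) and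
`…B4Sect5CubeBounds` (p245229: [6] (5.11)–(5.17) BUILT on `ℤ^d`, `hasSum517_lattice'`)).  VALUE = the typed predicate
`Eq242` is INHABITED by the model the print invokes (p. 264: *"As in [6], there is a random walk expansion for
C^{(k)}_Λ(u)"*): for every finite `Λ ⊂ ℤ^d`, every `A` on `L²(Λ; ℝ^N)` with [6] (5.6), and cubes of size `M ≥ 5`,
`M > K_R`, `M > Θ₁`, `Eq242 (A_Λ^{−1}(·,·)) (C_ω(·,·))` holds with `C_ω` the [6] Sect. 5 walk terms
(`eq242_lattice`).  NOT summit progress; NOT the covariance `C^{(k)}(u)` of the abelian Higgs model (whose operator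
`Δ(u) + …` of (2.40) is not typed in the tree); nothing landed is edited.

## The print (verbatim, p. 264 [PDF 8])

*"As in [6], there is a random walk expansion for C^{(k)}_Λ(u), C^{(k)}_Λ(u; x₁, x₂) = Σ_ω C^{(k)}_{Λ,ω}(u, x₁, x₂),
(2.42) based on the exponential decay of (Δ(u) + …)."* — [6] p. 595 [PDF 25]: *"C_Λ = Σ_ω h_{ω₀}C_{ω₀}h_{ω₀}
R_{ω₁,ω₂}C_{ω₂}h_{ω₂}·…·R_{ω_{2n−1},ω_{2n}}C_{ω_{2n}}h_{ω_{2n}}, ω = (ω₀,ω₁,…,ω_{2n}), ω_i are arbitrary indices j,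
but satisfying the restrictions max_{μ=1,…,d}|ω_{2i,μ} − ω_{2i+1,μ}| ≤ 1 for i = 0,1,…,n−1, n ≥ 0. (5.17)"*

## Typing decisions

* The walks of [6] (5.17) are typed in `…B4Sect5RandomWalk` as `Σ n, J × (Fin n → J × J)` (start `ω₀` and `n` PAIRS);
  (2.42)'s `ω` in `…BIJ88RandomWalk242` is a label sequence `Walk J` (start, `len`, `steps`).  `flatten` sends the
  former to the latter (`len = 2n`; injective, `flatten_injective`), and `C_ω` (`latticeCw`) is the walk term on the
  range of `flatten`, `0` elsewhere (`Function.extend`, `hasSum_extend_zero`) — label sequences of odd length carry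
  no term, exactly as in the print's indexing `ω = (ω₀, …, ω_{2n})`.
* `HasSum` in the `ℓ^∞` operator norm of `Matrix (B4.Idx Λ N) (B4.Idx Λ N) ℝ` (scope `Matrix.Norms.Operator`, as in
  `…B4Sect5CubeBounds`) passes to every entry because entry evaluation is norm-bounded (`abs_entry_le_norm`).
* Constants `K_R = B4Sect5CubeBounds.kR`, `Θ₁ = B4Sect5CubeBounds.thetaConst` (explicit functions of
  `d, N, γ₀, c₀, δ₀`); "M large" = `M ≥ 5 ∧ M > K_R ∧ M > Θ₁`.

## What is kernel-checked (no sorries; axioms propext / Classical.choice / Quot.sound)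

`flatten`, `flatten_injective`; `entryHom`, `abs_entry_le_norm`; `latticeCw`, `latticeCw_flatten`,
**`hasSum_latticeCw : HasSum C_ω A⁻¹`**, **`eq242_lattice : Eq242 (A⁻¹ · ·) (C_ω · ·)`**.
-/

namespace Literature.MathematicalPhysics.QuantumFieldTheory.BalabanImbrieJaffe1984to88.BIJ88Eq242Lattice

open scoped BigOperators
open Finset
open Literature.MathematicalPhysics.QuantumFieldTheory.Balaban1983to89
open Literature.MathematicalPhysics.QuantumFieldTheory.BalabanImbrieJaffe1984to88
open B4Sect5RandomWalk B4Sect5CubeBounds B4Sect5Proof BIJ88RandomWalk242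
open scoped Matrix Matrix.Norms.Operator

/-! ## §1 flattening the §5 walks `(ω₀; (ω₁,ω₂), …, (ω_{2n−1},ω_{2n}))` into label sequences -/

variable {J : Type*}

/-- index arithmetic for the flattening. [folklore] (bookkeeping for Bałaban–Imbrie–Jaffe, CMP **114**, (2.42)) -/
private theorem half_lt {n : ℕ} (i : Fin (2 * n)) : i.val / 2 < n := by
  have := i.isLt; omega

/-- the label sequence `ω₀, ω₁, …, ω_{2n}` of a [6] Sect. 5 walk `(ω₀; (ω₁,ω₂), …, (ω_{2n−1},ω_{2n}))` (p. 595: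
*"ω = (ω₀,ω₁,…,ω_{2n}), ω_i are arbitrary indices j"*), as a `BIJ88RandomWalk242.Walk` (start `ω₀`, `2n` steps).
[cite: Balaban1983RegularityDecay, (5.17) p.595] -/
def flatten (ω : Σ n : ℕ, J × (Fin n → J × J)) : Walk J where
  start := ω.2.1
  len := 2 * ω.1
  steps := fun i => if i.val % 2 = 0 then (ω.2.2 ⟨i.val / 2, half_lt i⟩).1 else (ω.2.2 ⟨i.val / 2, half_lt i⟩).2

/-- flattening is injective (a walk of [6] (5.17) is its label sequence). [cite: Balaban1983RegularityDecay, (5.17) p.595] -/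
theorem flatten_injective : Function.Injective (flatten (J := J)) := by
  rintro ⟨n, j, ys⟩ ⟨n', j', ys'⟩ h
  have hn : n = n' := by
    have := congrArg Walk.len h
    simp only [flatten] at this
    omega
  subst hn
  simp only [flatten, Walk.mk.injEq, heq_eq_eq, true_and] at h
  obtain ⟨hj, hst⟩ := h
  subst hj
  have hys : ys = ys' := by
    funext k
    have h0 := congrFun hst ⟨2 * k.val, by omega⟩
    have h1 := congrFun hst ⟨2 * k.val + 1, by omega⟩
    simp only [Nat.mul_mod_right, ↓reduceIte] at h0
    have hne : ¬ ((2 * k.val + 1) % 2 = 0) := by omega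
    simp only [hne, ↓reduceIte] at h1
    have ek : ∀ (q : 2 * k.val / 2 < n), (⟨2 * k.val / 2, q⟩ : Fin n) = k := fun q => Fin.ext (by simp)
    have ek' : ∀ (q : (2 * k.val + 1) / 2 < n), (⟨(2 * k.val + 1) / 2, q⟩ : Fin n) = k :=
      fun q => Fin.ext (by simp only; omega)
    simp only [ek] at h0
    simp only [ek'] at h1
    exact Prod.ext h0 h1
  subst hys
  rfl

/-! ## §2 entry evaluation is continuous in the `ℓ^∞` operator norm -/

section Entry

variable {m : Type*} [Fintype m]

/-- the entry `(x₁, x₂)` of a kernel on `L²(Λ; ℝ^N)`, as an additive map (the print's `C(x₁, x₂)`). [folklore] (bookkeeping for Bałaban–Imbrie–Jaffe, CMP **114**, (2.42)) -/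
def entryHom (x₁ x₂ : m) : Matrix m m ℝ →+ ℝ where
  toFun B := B x₁ x₂
  map_zero' := rfl
  map_add' _ _ := rfl

/-- an entry is bounded by the `ℓ^∞` operator norm (`Matrix.linftyOpNormedRing`): `|B(x₁,x₂)| ≤ ‖B‖`.
[cite: Balaban1983RegularityDecay, p.595 (‖R‖ ≤ max{sup_jΣ_{j′}‖R_{j,j′}‖, …})] -/
theorem abs_entry_le_norm (B : Matrix m m ℝ) (x₁ x₂ : m) : |B x₁ x₂| ≤ ‖B‖ := by
  rw [Matrix.linfty_opNorm_def]
  have h1 : (‖B x₁ x₂‖₊ : NNReal) ≤ ∑ j, ‖B x₁ j‖₊ :=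
    Finset.single_le_sum (f := fun j => ‖B x₁ j‖₊) (fun _ _ => bot_le) (Finset.mem_univ x₂)
  have h2 : (∑ j, ‖B x₁ j‖₊ : NNReal) ≤ Finset.univ.sup fun i => ∑ j, ‖B i j‖₊ :=
    Finset.le_sup (f := fun i => ∑ j, ‖B i j‖₊) (Finset.mem_univ x₁)
  have h3 : ((‖B x₁ x₂‖₊ : NNReal) : ℝ) ≤ ((Finset.univ.sup fun i => ∑ j, ‖B i j‖₊ : NNReal) : ℝ) := by
    exact_mod_cast h1.trans h2
  rw [coe_nnnorm, Real.norm_eq_abs] at h3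
  exact h3

/-- entry evaluation is continuous in the `ℓ^∞` operator norm. [folklore] (bookkeeping for Bałaban–Imbrie–Jaffe, CMP **114**, (2.42)) -/
private theorem continuous_entryHom (x₁ x₂ : m) : Continuous (entryHom (m := m) x₁ x₂) :=
  AddMonoidHomClass.continuous_of_bound (entryHom x₁ x₂) 1 fun B => by
    rw [one_mul, Real.norm_eq_abs]; exact abs_entry_le_norm B x₁ x₂

end Entry

/-! ## §3 the `ℤ^d` instance of (2.42) -/

variable {d N : ℕ} {Λ : Finset (Fin d → ℤ)} {γ₀ c₀ δ₀ : ℝ}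

/-- the terms `C_ω` of **(2.42)** for the operator `A_Λ` of [6] Sect. 5 on `L²(Λ; ℝ^N)`: the walk term
`h_{ω₀}C_{ω₀}h_{ω₀}R_{ω₁,ω₂}C_{ω₂}h_{ω₂}⋯R_{ω_{2n−1},ω_{2n}}C_{ω_{2n}}h_{ω_{2n}}` of [6] (5.17) (`B4Sect5RandomWalk.walkTerm517` with the
lattice data of `B4Sect5CubeBounds`) on the flattened label sequences, `0` on sequences that are not flattened §5 walks (odd
length). [cite: BalabanImbrieJaffe1988, (2.42) p.264; Balaban1983RegularityDecay, (5.17) p.595] -/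
noncomputable def latticeCw (M : ℕ) (Λ : Finset (Fin d → ℤ)) (N : ℕ) (A : Matrix (B4.Idx Λ N) (B4.Idx Λ N) ℝ) :
    Walk ↥(labels M Λ) → Matrix (B4.Idx Λ N) (B4.Idx Λ N) ℝ :=
  Function.extend flatten
    (walkTerm517 (aFac (hFam N M Λ) (cFam M A)) (bFac A (pFam N M Λ) (hFam N M Λ) (cFam M A))) 0

/-- on flattened walks `C_ω` is the [6] Sect. 5 walk term. [cite: Balaban1983RegularityDecay, (5.17) p.595] -/
theorem latticeCw_flatten (M : ℕ) (A : Matrix (B4.Idx Λ N) (B4.Idx Λ N) ℝ)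
    (ω : Σ n : ℕ, ↥(labels M Λ) × (Fin n → ↥(labels M Λ) × ↥(labels M Λ))) :
    latticeCw M Λ N A (flatten ω) =
      walkTerm517 (aFac (hFam N M Λ) (cFam M A)) (bFac A (pFam N M Λ) (hFam N M Λ) (cFam M A)) ω :=
  flatten_injective.extend_apply _ _ ω

/-- the operator form: `Σ_ω C_ω = A_Λ^{−1}` unconditionally (`B4Sect5CubeBounds.hasSum517_lattice'` transported along `flatten`,
`hasSum_extend_zero`). [cite: BalabanImbrieJaffe1988, (2.42) p.264; Balaban1983RegularityDecay, (5.16)–(5.17) p.595] -/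
theorem hasSum_latticeCw (hγ : 0 < γ₀) (hc : 0 ≤ c₀) (hδ : 0 < δ₀) {A : Matrix (B4.Idx Λ N) (B4.Idx Λ N) ℝ}
    (hA : B4.Hyp56 Λ A γ₀ c₀ δ₀) {M : ℕ} (hM : 5 ≤ M) (hMR : kR d N γ₀ c₀ δ₀ < M)
    (hMθ : thetaConst d N γ₀ c₀ δ₀ < M) : HasSum (latticeCw M Λ N A) A⁻¹ :=
  (hasSum_extend_zero flatten_injective).mpr (hasSum517_lattice' hγ hc hδ hA hM hMR hMθ)

/-- **(2.42) INSTANTIATED ON `ℤ^d` FOR THE OPERATORS OF [6] SECT. 5** p. 264 [PDF 8]: *"a random walk expansion for C^{(k)}_Λ(u),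
C^{(k)}_Λ(u; x₁, x₂) = Σ_ω C^{(k)}_{Λ,ω}(u, x₁, x₂) (2.42)"* — here for `C := A_Λ^{−1}`, `A` any operator on `L²(Λ; ℝ^N)`, `Λ ⊂ ℤ^d`
finite, with [6] (5.6) (`B4.Hyp56 Λ A γ₀ c₀ δ₀`), cubes of size `M ≥ 5`, `M > K_R`, `M > Θ₁` (`B4Sect5CubeBounds.kR`,
`.thetaConst`): `Eq242 (A_Λ^{−1}(x₁,x₂)) (C_ω(x₁,x₂))`, the sum over ALL label sequences `ω` converging unconditionally,
entrywise.  This is the typed predicate `BIJ88RandomWalk242.Eq242` inhabited by the model the print cites (*"as in [6]"*); it is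
NOT the covariance `C^{(k)}(u)` of the abelian Higgs model itself. [cite: BalabanImbrieJaffe1988, (2.42) p.264;
Balaban1983RegularityDecay, (5.16)–(5.17) p.595] -/
theorem eq242_lattice (hγ : 0 < γ₀) (hc : 0 ≤ c₀) (hδ : 0 < δ₀) {A : Matrix (B4.Idx Λ N) (B4.Idx Λ N) ℝ}
    (hA : B4.Hyp56 Λ A γ₀ c₀ δ₀) {M : ℕ} (hM : 5 ≤ M) (hMR : kR d N γ₀ c₀ δ₀ < M)
    (hMθ : thetaConst d N γ₀ c₀ δ₀ < M) :
    Eq242 (fun x₁ x₂ : B4.Idx Λ N => A⁻¹ x₁ x₂) (fun ω x₁ x₂ => latticeCw M Λ N A ω x₁ x₂) :=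
  fun x₁ x₂ => (hasSum_latticeCw hγ hc hδ hA hM hMR hMθ).map (entryHom x₁ x₂) (continuous_entryHom x₁ x₂)

/-! ## §4 (2.45) — and (2.49) — for the `ℤ^d` operators: the resummed partition identity (v1.1, gen 5)

p. 264 [PDF 8]: *"Then we define C^{(k)}_Λ(u) = C^{(k)}_{Λ,loc}(u) + Σ_X C^{(k)}_{Λ,X}(u), (2.45)"*; p. 265 [PDF 9]: *"Lastly
we note that the single-step covariance for the gauge field can be given a random walk expansion analogous to (2.45), with
similar estimates: C^{(k)}_Λ = C^{(k)}_{Λ,loc} + Σ_X C^{(k)}_{Λ,X}. (2.49)"*.  In the operator model of [6] Sect. 5 both are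
ONE statement: for EVERY finite `Λ ⊂ ℤ^d`, every number `N` of components (scalar field: the colour components; a
bond/vector-valued covariance as in (2.49): `N` = the bond directions at a site) and every operator `A` on `L²(Λ; ℝ^N)`
with (5.6), the expansion (2.42) (`eq242_lattice`) resums into the local part `C_{Λ,loc} = Σ′_ω C_ω` (walks within `ρ`
of both arguments for ANY label-to-site distance `ldist` and radius `ρ`, print: `ρ = ¼r(e_k)`) plus the parts
`C_{Λ,X} = Σ^X_ω C_ω` indexed by the cube regions `X` (ANY coarse cube map `cubeOf` on the labels with adjacency `cadj`,
print: the `r(e_k)`-cubes) — `BIJ88RandomWalk242.eq245_of_eq242` applied to the lattice instance.  The identification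
of `A` with the print's `Δ_{k,loc}(u) + aL^{−2}Q(u)*Q(u)` of (2.40), resp. with [14]'s gauge-field covariance for (2.49),
is NOT made here (those operators' (5.6) is the analytic input, rows C2.Eq2.38 / C1.Eq4.3.3). -/

/-- **(2.45)/(2.49) INSTANTIATED ON `ℤ^d`**: for the operators of [6] Sect. 5 (finite `Λ ⊂ ℤ^d`, `A` on `L²(Λ; ℝ^N)`
with (5.6), cubes `M ≥ 5`, `M > K_R`, `M > Θ₁`), the inverse `A_Λ^{−1}` IS its local part plus the sum of its `X`-parts,
`A_Λ^{−1}(x₁,x₂) = C_{Λ,loc}(x₁,x₂) + Σ_X C_{Λ,X}(x₁,x₂)` (`BIJ88Sect2Statements.Eq245`), for every label-to-site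
distance `ldist`, radius `ρ`, cube map `cubeOf` and cube adjacency `cadj` (the print's `¼r(e_k)` and `r(e_k)`-cubes
being one choice).  The same statement serves (2.49) (*"analogous to (2.45)"*) for a vector/bond-valued covariance
read as an operator on `L²(Λ; ℝ^N)`. [cite: BalabanImbrieJaffe1988, (2.45) p.264, (2.49) p.265] -/
theorem eq245_lattice (hγ : 0 < γ₀) (hc : 0 ≤ c₀) (hδ : 0 < δ₀) {A : Matrix (B4.Idx Λ N) (B4.Idx Λ N) ℝ}
    (hA : B4.Hyp56 Λ A γ₀ c₀ δ₀) {M : ℕ} (hM : 5 ≤ M) (hMR : kR d N γ₀ c₀ δ₀ < M)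
    (hMθ : thetaConst d N γ₀ c₀ δ₀ < M) {κ : Type*} [Fintype κ] [DecidableEq κ]
    (ldist : ↥(labels M Λ) → B4.Idx Λ N → ℝ) (ρ : ℝ) (cubeOf : ↥(labels M Λ) → κ) (cadj : κ → κ → Prop) :
    BIJ88Sect2Statements.Eq245 (fun x₁ x₂ : B4.Idx Λ N => A⁻¹ x₁ x₂)
      (cLoc ldist ρ (fun ω x₁ x₂ => latticeCw M Λ N A ω x₁ x₂))
      (cX ldist ρ cubeOf cadj (fun ω x₁ x₂ => latticeCw M Λ N A ω x₁ x₂)) :=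
  eq245_of_eq242 ldist ρ cubeOf cadj (eq242_lattice hγ hc hδ hA hM hMR hMθ)

/-- **(2.45) for the Dirichlet restrictions `C^{(k)}_Λ(Ω,·) = [A|_Λ]^{−1}` of (2.39)**, *"C^{(k)}_Λ(Ω,u) =
[(Δ_k(Ω,u) + aL^{−2}Q(u)*Q(u))|_Λ]^{−1} (2.39)"*: (5.6) passes from an operator `A` on `L²(Ω; ℝ^N)` to each of its
compressions `A|_Λ`, `Λ ⊆ Ω` (`B6GOmega.hyp56_compress`), so the expansion (2.42) and the partition identity (2.45) hold
for `[A|_Λ]^{−1}` for EVERY `Λ ⊆ Ω`, with the SAME constants. [cite: BalabanImbrieJaffe1988, (2.39) p.264, (2.45) p.264] -/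
theorem eq245_compress (hγ : 0 < γ₀) (hc : 0 ≤ c₀) (hδ : 0 < δ₀) {Ω : Finset (Fin d → ℤ)}
    {A : Matrix (B4.Idx Ω N) (B4.Idx Ω N) ℝ} (hA : B4.Hyp56 Ω A γ₀ c₀ δ₀) (hΛ : Λ ⊆ Ω) {M : ℕ} (hM : 5 ≤ M)
    (hMR : kR d N γ₀ c₀ δ₀ < M) (hMθ : thetaConst d N γ₀ c₀ δ₀ < M) {κ : Type*} [Fintype κ] [DecidableEq κ]
    (ldist : ↥(labels M Λ) → B4.Idx Λ N → ℝ) (ρ : ℝ) (cubeOf : ↥(labels M Λ) → κ) (cadj : κ → κ → Prop) :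
    BIJ88Sect2Statements.Eq245 (fun x₁ x₂ : B4.Idx Λ N => (B4.compress hΛ A)⁻¹ x₁ x₂)
      (cLoc ldist ρ (fun ω x₁ x₂ => latticeCw M Λ N (B4.compress hΛ A) ω x₁ x₂))
      (cX ldist ρ cubeOf cadj (fun ω x₁ x₂ => latticeCw M Λ N (B4.compress hΛ A) ω x₁ x₂)) :=
  eq245_lattice hγ hc hδ (B6GOmega.hyp56_compress hΛ hγ.le hc hδ.le hA) hM hMR hMθ ldist ρ cubeOf cadj

end Literature.MathematicalPhysics.QuantumFieldTheory.BalabanImbrieJaffe1984to88.BIJ88Eq242Lattice
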